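import Literature.Probability.Percolation.CutPointArms
import Literature.Probability.Percolation.AltFourArm
import Literature.Probability.Percolation.OneArmPivotalBound
import HarnessLib

/-!
# Four ALTERNATING arms around a cut point (cluster form), and the pivotal bound for the one-arm event (proofs only)

Topic `Literature/Probability/Percolation`; family `crit-perc`, statement **crit-perc.S16**
(`Literature.Probability.Percolation.triTheta_exponent`); serves the discharge of
`Literature.Probability.Percolation.Nolin2008_thm27_oneArm` (Nolin 2008, Thm. 27, `j = 1`).
PROOFS ONLY (no definition, no named fact).

`CutPointArms.lean` proves that a cut point has four arms open/closed/open/closed in the tree's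
ORDER-FREE event `armEvent ![T, F, T, F] 1 d` (two open and two closed disjoint crossings of
`Λ_d \ Λ_0`, cyclic arrangement not prescribed). The arms produced there are in fact alternating,
and this file re-runs the same padded Hex-lemma argument (Nolin 2008, §6.2, proof of Thm. 27,
Case 1, Fig. 8 [arXiv 0711.4948: Thm. 26]; Werner 2009, Lecture 6, §5; Kesten 1987, Lemma 8) with
the stronger conclusion `altFourArm 1 d` (`AltFourArm.lean`: the alternating four-arm event in
CLUSTER FORM — the two open arms are not joined by an open path of the annulus, the two closed
arms not by a closed one), which is the form of Werner's `π̂_p` used by Kesten's near-critical arm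
calculus for one colour sequence at a time. The two extra conditions come for free from the
argument of `CutPointArms.lean`:

* the open arms are pieces of the two given open paths `α`, `β`, which by the cut-point
  hypothesis are not joined by any open path of `[-d, d]² \ {0} ⊇ Λ_d \ Λ_0`;
* the closed arms are the two halves of the white top–bottom crossing `κ` of the padded box
  `[-d-3, d+3]²` split at `0`; a closed path of `Λ_d \ Λ_0` joining them would, together with the
  two ends of `κ`, be a white top–bottom crossing avoiding `0`, which the exclusivity half of the
  Hex lemma (`tri_hex_excl`) forbids in presence of the black left–right crossing
  wires + `α ∪ {0} ∪ β` (the same contradiction that proves the two halves disjoint).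

Contents (all proofs follow `CutPointArms.lean` / `OneArmPivotalBound.lean` line by line; only the
assembly of the arms and the transport lemmas change):

* `mem_altFourArm_of_pathIn` — the analogue of `mem_armEvent_of_pathIn` for `altFourArm`: four
  pairwise disjoint coloured site sets in the annulus, each containing a path from `∂Λ_r` to
  `∂Λ_R`, with the two separation hypotheses, realise `altFourArm r R`;
* `altFourArm_of_cutPoint_of_wires`, `altFourArm_of_cutPoint_right`,
  `mem_altFourArm_of_relabel_iso`, `altFourArm_of_cutPoint_iso`, `altFourArm_of_cutPoint` — the
  cut-point lemma in cluster form and its transport by the symmetries of `𝕋`;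
* `relabel_shift_mem_altFourArm_of_isPivotal_triOneArm` — a pivotal site `v` of the one-arm event
  `{0 ↔ ∂Λ_N}` with `2d + 1 ≤ |v|_𝕋 ≤ N - 2d` has `ω - v ∈ altFourArm 1 d`;
* `isPivotal_triOneArm_subset_alt`, `determinedBy_preimage_shift_altFourArm`,
  `measureReal_isPivotal_triOneArm_le_alt` — the pivotal bound of `OneArmPivotalBound.lean` with
  Werner's alternating `π̂^alt_t(r₀, d) = altFourArmProbAt t r₀ d` in place of the order-free
  `fourArmProbAt`:
  `P_t(v pivotal for 0 ↔ ∂Λ_N) ≤ P_t(0 ↔ ∂Λ_m) · π̂^alt_t(r₀, d) · P_t(armEvent ![T] m' N)`.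

## References

* P. Nolin, Near-critical percolation in two dimensions, *Electron. J. Probab.* 13 (2008),
  §4.1 (the events `A_{j,σ}`, `σ = BWBW` in cyclic order), §6.2, proof of Thm. 27, Case 1 and
  Fig. 8 [arXiv 0711.4948: Thm. 26] [Nolin2008].
* W. Werner, *Lectures on two-dimensional critical percolation*, IAS/Park City Math. Ser. 16
  (2009), Lecture 6, §4 (`π̂_p`), §5 (pivotal points of the one-arm event) [WernerPCMI2009].
* H. Kesten, Scaling relations for 2D-percolation, *Comm. Math. Phys.* 109 (1987), §1 (1.12),
  Lemma 8 [KestenScalingCMP1987].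
* B. Bollobás, O. Riordan, *Percolation*, CUP (2006), Ch. 5, Lemma 7 (Hex lemma)
  [BollobasRiordan2006].

Tree: everything of `CutPointArms.lean` (`triSqBox`, `tri_hex_triSqBox`, `tri_hex_excl_triSqBox`,
`CutPointWires`, `exists_cutPointWires`, `triNorm_transposeIso`, `triNorm_add_le`,
`triNorm_le_abs_add_abs`), `altFourArm`, `altFourArmProbAt`, `triAnn`, `mem_triAnn`,
`altFourArm_mono_left`, `determinedBy_altFourArm` (`AltFourArm.lean`), `mem_triOneArm_of_pathIn_triNorm`,
`mem_armEvent_one_of_pathIn_ball`, `le_triNorm_of_mem_shift_annulus`,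
`triNorm_le_add_of_mem_shift_annulus` (`OneArmPivotalBound.lean`), `PathIn` API (`SitePaths.lean`,
`TriRSWChaining.lean`, `OneArmLSW.lean`, `ParaPivotalArms.lean`). Mathlib: `SimpleGraph.Walk.toPath`,
`SimpleGraph.Walk.map`, `Fin` case analysis.
-/

noncomputable section

open MeasureTheory Set

namespace Literature.Probability.Percolation

open LatticeModels

/-! ### Alternating arms from coloured site sets -/

/-- **`altFourArm` from four coloured site sets.** The analogue of `mem_armEvent_of_pathIn`
(`ParaPivotalArms.lean`): four pairwise disjoint site sets `T 0, …, T 3` of colours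
open/closed/open/closed inside the annulus `{r ≤ |·| ≤ R}`, each containing a path from `∂Λ_r` to
`∂Λ_R`, such that no open path of the annulus joins `T 0` to `T 2` and no closed one joins `T 1`
to `T 3`, realise the alternating four-arm event in cluster form (the arms are the loop-erased
paths, whose supports stay inside the `T i`). [cite: Nolin2008, §4.1 (arXiv 0711.4948, §4.1)] -/
theorem mem_altFourArm_of_pathIn {r R : ℕ} {ω : SiteConfig (Site 2)}
    (T : Fin 4 → Set (Site 2)) (hT : Pairwise fun i j => Disjoint (T i) (T j))
    (hcol : ∀ i, ∀ z ∈ T i, (z ∈ ω ↔ (![true, false, true, false] : Fin 4 → Bool) i = true))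
    (hann : ∀ i, ∀ z ∈ T i, (r : ℤ) ≤ triNorm z ∧ triNorm z ≤ R)
    (hp : ∀ i, ∃ x ∈ triSphere r, ∃ y ∈ triSphere R, PathIn triGraph (T i) x y)
    (hsep₀₂ : ∀ u ∈ T 0, ∀ u' ∈ T 2, ¬ PathIn triGraph (triAnn r R ∩ ω) u u')
    (hsep₁₃ : ∀ u ∈ T 1, ∀ u' ∈ T 3, ¬ PathIn triGraph (triAnn r R \ ω) u u') :
    ω ∈ altFourArm r R := by
  classical
  choose x hx y hy hpath using hp
  have hw : ∀ i, ∃ W : triGraph.Walk (x i) (y i), ∀ z ∈ W.support, z ∈ T i :=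
    fun i => (hpath i).exists_walk
  choose W hW using hw
  have hsub : ∀ i, ∀ z ∈ ((W i).toPath : triGraph.Walk (x i) (y i)).support, z ∈ T i :=
    fun i z hz => hW i z (SimpleGraph.Walk.support_toPath_subset_support (W i) hz)
  refine ⟨x, y, fun i => ((W i).toPath : triGraph.Walk (x i) (y i)), fun i => ?_, ?_, ?_, ?_⟩
  · refine ⟨hx i, hy i, (W i).toPath.2, fun z hz => ?_, fun z hz => ?_⟩
    · obtain ⟨h1, h2⟩ := hann i z (hsub i z hz)
      rcases eq_or_lt_of_le h1 with h1 | h1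
      · right; rw [mem_triSphere_iff, ← h1]
      · left
        simp only [mem_sdiff, Finset.mem_coe, mem_triBall_iff, not_le]
        exact ⟨h2, h1⟩
    · have := hcol i z (hsub i z hz)
      simpa using this
  · intro i j hij
    rw [Finset.disjoint_left]
    intro z hzi hzj
    exact Set.disjoint_left.1 (hT hij) (hsub i z (List.mem_toFinset.1 hzi))
      (hsub j z (List.mem_toFinset.1 hzj))
  · exact fun u hu u' hu' => hsep₀₂ u (hsub 0 u hu) u' (hsub 2 u' hu')
  · exact fun u hu u' hu' => hsep₁₃ u (hsub 1 u hu) u' (hsub 3 u' hu')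

/-- Sites of the annulus `{1 ≤ |·| ≤ d}` are sites of `[-d, d]²` other than `0`. [folklore] -/
theorem triAnn_one_subset_triSqBox_diff (d : ℕ) : triAnn 1 d ⊆ triSqBox d \ {0} := by
  intro z hz
  rw [mem_triAnn] at hz
  refine ⟨mem_triSqBox_of_triNorm_le hz.2, fun h => ?_⟩
  rw [mem_singleton_iff] at h
  rw [h] at hz
  simp [triNorm] at hz

/-! ### The cut-point lemma in cluster form, given wires -/

section CutPoint

variable {d : ℕ} {ξ : SiteConfig (Site 2)} {Sα Sβ Wa Wb : Set (Site 2)} {a₁ a a' b₁ b b' : Site 2}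

/-- **The cut-point lemma with given wires, cluster form** (the padded Hex-lemma argument of
`armEvent_of_cutPoint_of_wires`, `CutPointArms.lean`, with the alternating conclusion: the open
arms inherit the cut-point hypothesis, the closed halves of the white crossing are not joined by
a closed path avoiding `0` by the exclusivity of the Hex lemma). [cite: Nolin2008, §6.2, proof of Thm. 27, Case 1 (arXiv 0711.4948: Thm. 26, Fig. 8)] [cite: BollobasRiordan2006, Ch. 5 Lemma 7] -/
theorem altFourArm_of_cutPoint_of_wires (hd : 1 ≤ d) (hW : CutPointWires d a a' b b' Wa Wb)
    (hSα : Sα ⊆ (triSqBox d \ {0}) ∩ ξ) (hSβ : Sβ ⊆ (triSqBox d \ {0}) ∩ ξ)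
    (ha₁ : triGraph.Adj a₁ 0) (hb₁ : triGraph.Adj b₁ 0) (hα : PathIn triGraph Sα a₁ a)
    (hβ : PathIn triGraph Sβ b₁ b) (hda : (d : ℤ) ≤ triNorm a) (hdb : (d : ℤ) ≤ triNorm b)
    (H : ∀ z ∈ Sα, ∀ z' ∈ Sβ, ¬ PathIn triGraph ((triSqBox d \ {0}) ∩ ξ) z z') :
    ξ ∈ altFourArm 1 d := by
  classical
  set L : ℕ := d + 3 with hL
  set P : Set (Site 2) := triSqBox d with hP
  -- the colourings
  set B₀ : Set (Site 2) := Wa ∪ Wb ∪ ((P \ {0}) ∩ ξ) with hB₀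
  set B₁ : Set (Site 2) := insert 0 B₀ with hB₁
  have hPL : P ⊆ triSqBox L := triSqBox_mono (by omega)
  have h0P : (0 : Site 2) ∈ P := by rw [hP, mem_triSqBox]; simp
  have haSα : a ∈ Sα := hα.right_mem
  have hbSβ : b ∈ Sβ := hβ.right_mem
  have ha₁Sα : a₁ ∈ Sα := hα.left_mem
  have hb₁Sβ : b₁ ∈ Sβ := hβ.left_mem
  have hB₀B₁ : B₀ ⊆ B₁ := subset_insert _ _
  -- (1) the black left–right crossing of `P⁺` under `B₁`
  obtain ⟨ea, hea, hea0, hpa⟩ := hW.Wa_path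
  obtain ⟨eb, heb, heb0, hpb⟩ := hW.Wb_path
  have hSαB : Sα ⊆ triSqBox L ∩ B₁ := fun z hz =>
    ⟨hPL (hSα hz).1.1, hB₀B₁ (Or.inr (hSα hz))⟩
  have hSβB : Sβ ⊆ triSqBox L ∩ B₁ := fun z hz =>
    ⟨hPL (hSβ hz).1.1, hB₀B₁ (Or.inr (hSβ hz))⟩
  have haWa : insert a Wa ⊆ triSqBox L ∩ B₁ := by
    rintro z (rfl | hz)
    · exact hSαB haSα
    · exact ⟨hW.Wa_sub hz, hB₀B₁ (Or.inl (Or.inl hz))⟩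
  have hbWb : insert b Wb ⊆ triSqBox L ∩ B₁ := by
    rintro z (rfl | hz)
    · exact hSβB hbSβ
    · exact ⟨hW.Wb_sub hz, hB₀B₁ (Or.inl (Or.inr hz))⟩
  have h0B₁ : (0 : Site 2) ∈ triSqBox L ∩ B₁ := ⟨hPL h0P, mem_insert _ _⟩
  have hcross : PathIn triGraph (triSqBox L ∩ B₁) eb ea :=
    (((((hpb.mono hbWb).symm.trans (hβ.mono hSβB).symm).tail hb₁ h0B₁).tail ha₁.symm
      (hSαB ha₁Sα)).trans (hα.mono hSαB)).trans (hpa.mono haWa)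
  have hexcl : ∀ {u w : Site 2}, u 1 = -(L : ℤ) → w 1 = L →
      PathIn triGraph (triSqBox L ∩ B₁ᶜ) u w → False := fun hu hw huw =>
    tri_hex_excl_triSqBox L B₁ (by rw [heb0, hL]; push_cast; ring) (by rw [hea0, hL]; push_cast; ring)
      hcross hu hw huw
  -- (2) no black left–right crossing of `P⁺` under `B₀`
  have hnoblack : ∀ {x y : Site 2}, x 0 = -(L : ℤ) → y 0 = L →
      PathIn triGraph (triSqBox L ∩ B₀) x y → False := by
    intro x y hx hy hp
    -- the endpoints lie on the wires
    have hxWb : x ∈ Wb := by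
      rcases hp.left_mem.2 with (h | h) | h
      · exact absurd hx (hW.Wa_left x h)
      · exact h
      · have := (h.1.1 : x ∈ triSqBox d); rw [mem_triSqBox, abs_le] at this; omega
    have hyWa : y ∈ Wa := by
      rcases hp.right_mem.2 with (h | h) | h
      · exact h
      · exact absurd hy (hW.Wb_right y h)
      · have := (h.1.1 : y ∈ triSqBox d); rw [mem_triSqBox, abs_le] at this; omega
    have hyWb : y ∉ Wb := fun h => Set.disjoint_left.1 hW.disj hyWa h
    -- last exit from `Wb`
    obtain ⟨p, q, hpWb, -, hqWb, hpq, hq⟩ := hp.last_exit hxWb hyWb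
    have hqmem := hq.left_mem
    have hqP : q ∈ P ∧ q ≠ 0 ∧ q ∈ ξ := by
      rcases hqmem.1.2 with (h | h) | h
      · exact absurd hpq.symm (hW.apart q h p hpWb)
      · exact absurd h hqmem.2
      · exact ⟨h.1.1, h.1.2, h.2⟩
    have hqb : q = b ∨ q = b' := hW.Wb_touch p hpWb q hqP.1 hpq
    -- first entry into `Wa`
    have hqWa : q ∈ Waᶜ := fun h => hW.Wa_out q h hqP.1
    have hyWa' : y ∉ Waᶜ := fun h => h hyWa
    obtain ⟨r, s, hrWa, hsWa, -, hrs, hqr⟩ := hq.exit hqWa hyWa'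
    simp only [mem_compl_iff, not_not] at hsWa
    have hsub : Waᶜ ∩ ((triSqBox L ∩ B₀) \ Wb) ⊆ (P \ {0}) ∩ ξ := by
      rintro z ⟨hzWa, ⟨-, (h | h) | h⟩, hzWb⟩
      · exact absurd h hzWa
      · exact absurd h hzWb
      · exact h
    have hqr' : PathIn triGraph ((P \ {0}) ∩ ξ) q r := hqr.mono hsub
    have hrP := hqr'.right_mem
    have hra : r = a ∨ r = a' := hW.Wa_touch s hsWa r hrP.1.1 hrs.symm
    -- extend to a path from `b` to `a`
    have hqmem' : q ∈ (P \ {0}) ∩ ξ := hqr'.left_mem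
    have hbq : PathIn triGraph ((P \ {0}) ∩ ξ) b q := by
      have hqb' : q = b ∨ triGraph.Adj b q := by
        rcases hqb with h | h
        · exact Or.inl h
        · rw [h]; exact hW.b'_adj
      rcases hqb' with h | h
      · rw [h] at hqmem' ⊢; exact PathIn.refl hqmem'
      · exact PathIn.of_adj (hSβ hbSβ) hqmem' h
    have hra' : PathIn triGraph ((P \ {0}) ∩ ξ) r a := by
      have hra'' : r = a ∨ triGraph.Adj a r := by
        rcases hra with h | h
        · exact Or.inl h
        · rw [h]; exact hW.a'_adj
      rcases hra'' with h | h
      · rw [h] at hrP; rw [h]; exact PathIn.refl hrP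
      · exact PathIn.of_adj hrP (hSα haSα) h.symm
    exact H a haSα b hbSβ ((hbq.trans hqr').trans hra').symm
  -- (3) hence a white bottom–top crossing `κ` of `P⁺` under `B₀`, which passes through `0`
  obtain ⟨x, y, hx, hy, hκ⟩ := (tri_hex_triSqBox L B₀).resolve_left
    (fun ⟨x, y, hx, hy, hp⟩ => hnoblack hx hy hp)
  have hB₁c : (triSqBox L ∩ B₀ᶜ) \ {0} ⊆ triSqBox L ∩ B₁ᶜ := by
    rintro z ⟨⟨hz1, hz2⟩, hz0⟩
    refine ⟨hz1, fun h => ?_⟩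
    rcases mem_insert_iff.1 h with h | h
    · exact hz0 h
    · exact hz2 h
  have hx0 : x ≠ 0 := by intro h; rw [h, Pi.zero_apply] at hx; omega
  have hy0 : y ≠ 0 := by intro h; rw [h, Pi.zero_apply] at hy; omega
  rcases hκ.split_at 0 with havoid | ⟨hP₃, hP₄⟩
  · exact (hexcl hx hy (havoid.mono hB₁c)).elim
  obtain ⟨c₁, hc₁, hp₃⟩ := hP₃.resolve_left hx0
  obtain ⟨c₂, hc₂, hp₄⟩ := hP₄.resolve_left hy0
  obtain ⟨S₃, hS₃, hq₃, hall₃⟩ := hp₃.exists_support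
  obtain ⟨S₄, hS₄, hq₄, hall₄⟩ := hp₄.exists_support
  have h34 : Disjoint S₃ S₄ := by
    rw [Set.disjoint_left]
    intro z hz₃ hz₄
    exact hexcl hx hy ((((hall₃ z hz₃).mono hS₃).trans ((hall₄ z hz₄).mono hS₄).symm).mono hB₁c)
  -- (4) truncate the four arms at `∂Λ_d`
  have hdx : (d : ℤ) ≤ triNorm (x - 0) := by
    rw [sub_zero]
    have := (abs_le_triNorm x).2.1
    rw [hx, abs_neg, abs_of_nonneg (by positivity)] at this; omega
  have hdy : (d : ℤ) ≤ triNorm (y - 0) := by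
    rw [sub_zero]
    have := (abs_le_triNorm y).2.1
    rw [hy, abs_of_nonneg (by positivity)] at this; omega
  have hda' : (d : ℤ) ≤ triNorm (a - 0) := by rwa [sub_zero]
  have hdb' : (d : ℤ) ≤ triNorm (b - 0) := by rwa [sub_zero]
  obtain ⟨e₁, he₁, ht₁⟩ := hα.exists_trunc_arm ha₁ hd hda'
  obtain ⟨e₂, he₂, ht₂⟩ := hβ.exists_trunc_arm hb₁ hd hdb'
  obtain ⟨e₃, he₃, ht₃⟩ := hq₃.symm.exists_trunc_arm hc₁ hd hdx
  obtain ⟨e₄, he₄, ht₄⟩ := hq₄.symm.exists_trunc_arm hc₂ hd hdy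
  simp only [sub_zero] at he₁ he₂ he₃ he₄ ht₁ ht₂ ht₃ ht₄
  -- closed supports inside `Λ_d` are closed sites of `P \ {0}`
  have hclosed : ∀ {S : Set (Site 2)}, S ⊆ (triSqBox L ∩ B₀ᶜ) \ {0} →
      ∀ z ∈ S ∩ {w | triNorm w ≤ d}, z ∈ P ∧ z ≠ 0 ∧ z ∉ ξ := by
    intro S hS z hz
    obtain ⟨⟨-, hzB⟩, hz0⟩ := hS hz.1
    have hzP : z ∈ P := mem_triSqBox_of_triNorm_le hz.2
    exact ⟨hzP, hz0, fun h => hzB (Or.inr ⟨⟨hzP, hz0⟩, h⟩)⟩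
  -- (5) assemble the four arms
  let T : Fin 4 → Set (Site 2) :=
    ![Sα ∩ {w | triNorm w ≤ d}, S₃ ∩ {w | triNorm w ≤ d}, Sβ ∩ {w | triNorm w ≤ d},
      S₄ ∩ {w | triNorm w ≤ d}]
  have hSαβ : ∀ z ∈ Sα, ∀ z' ∈ Sβ, z ≠ z' := by
    intro z hz z' hz' hzz'
    subst hzz'
    exact H z hz z hz' (PathIn.refl (hSα hz))
  refine mem_altFourArm_of_pathIn T ?_ ?_ ?_ ?_ ?_ ?_
  · -- pairwise disjoint
    have oc : ∀ {A C : Set (Site 2)}, (∀ z ∈ A, z ∈ ξ) → (∀ z ∈ C, z ∉ ξ) →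
        Disjoint (A ∩ {w | triNorm w ≤ d}) C := by
      intro A C hA hC
      exact Set.disjoint_left.2 fun z hz hz' => hC z hz' (hA z hz.1)
    have co : ∀ {A C : Set (Site 2)}, (∀ z ∈ A, z ∉ ξ) → (∀ z ∈ C, z ∈ ξ) →
        Disjoint A (C ∩ {w | triNorm w ≤ d}) := by
      intro A C hA hC
      exact Set.disjoint_left.2 fun z hz hz' => hA z hz (hC z hz'.1)
    have hα' : ∀ z ∈ Sα, z ∈ ξ := fun z hz => (hSα hz).2
    have hβ' : ∀ z ∈ Sβ, z ∈ ξ := fun z hz => (hSβ hz).2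
    have h₃' : ∀ z ∈ S₃ ∩ {w | triNorm w ≤ d}, z ∉ ξ := fun z hz => (hclosed hS₃ z hz).2.2
    have h₄' : ∀ z ∈ S₄ ∩ {w | triNorm w ≤ d}, z ∉ ξ := fun z hz => (hclosed hS₄ z hz).2.2
    intro i j hij
    fin_cases i <;> fin_cases j
    · exact absurd rfl hij
    · exact oc hα' h₃'
    · exact Set.disjoint_left.2 fun z hz hz' => hSαβ z hz.1 z hz'.1 rfl
    · exact oc hα' h₄'
    · exact (oc hα' h₃').symm
    · exact absurd rfl hij
    · exact (oc hβ' h₃').symm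
    · exact Set.disjoint_left.2 fun z hz hz' => Set.disjoint_left.1 h34 hz.1 hz'.1
    · exact Set.disjoint_left.2 fun z hz hz' => hSαβ z hz'.1 z hz.1 rfl
    · exact oc hβ' h₃'
    · exact absurd rfl hij
    · exact oc hβ' h₄'
    · exact (oc hα' h₄').symm
    · exact Set.disjoint_left.2 fun z hz hz' => Set.disjoint_left.1 h34 hz'.1 hz.1
    · exact (oc hβ' h₄').symm
    · exact absurd rfl hij
  · -- colours
    intro i z hz
    fin_cases i
    · simpa using (hSα hz.1).2
    · simpa using (hclosed hS₃ z hz).2.2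
    · simpa using (hSβ hz.1).2
    · simpa using (hclosed hS₄ z hz).2.2
  · -- annulus
    have key : ∀ {S : Set (Site 2)}, (∀ z ∈ S, z ≠ (0 : Site 2)) →
        ∀ z ∈ S ∩ {w | triNorm w ≤ d}, ((1 : ℕ) : ℤ) ≤ triNorm z ∧ triNorm z ≤ d := by
      intro S hS z hz
      refine ⟨?_, hz.2⟩
      have := one_le_triNorm_sub_of_ne (hS z hz.1)
      rw [sub_zero] at this; exact_mod_cast this
    intro i
    fin_cases i
    · exact key fun z hz => (hSα hz).1.2
    · exact key fun z hz => (hS₃ hz).2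
    · exact key fun z hz => (hSβ hz).1.2
    · exact key fun z hz => (hS₄ hz).2
  · -- the arms
    have key : ∀ {S : Set (Site 2)} {u e : Site 2}, triGraph.Adj u 0 → triNorm e = d →
        PathIn triGraph (S ∩ {w | triNorm w ≤ d}) u e →
        ∃ x ∈ triSphere 1, ∃ y ∈ triSphere d, PathIn triGraph (S ∩ {w | triNorm w ≤ d}) x y := by
      intro S u e hu he hp
      refine ⟨u, ?_, e, by rwa [mem_triSphere_iff], hp⟩
      rw [mem_triSphere_iff]
      have := triNorm_sub_eq_one_of_adj hu
      rw [sub_zero] at this; exact_mod_cast this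
    intro i
    fin_cases i
    · exact key ha₁ he₁ ht₁
    · exact key hc₁ he₃ ht₃
    · exact key hb₁ he₂ ht₂
    · exact key hc₂ he₄ ht₄
  · -- the open arms are not joined by an open path of the annulus: the cut-point hypothesis
    intro u hu u' hu' hp
    have hsub : triAnn 1 d ∩ (ξ : Set (Site 2)) ⊆ (P \ {0}) ∩ ξ := fun z hz =>
      ⟨triAnn_one_subset_triSqBox_diff d hz.1, hz.2⟩
    exact H u hu.1 u' hu'.1 (hp.mono hsub)
  · -- the closed arms are not joined by a closed path of the annulus: exclusivity
    intro u hu u' hu' hp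
    have hsub : triAnn 1 d \ (ξ : Set (Site 2)) ⊆ triSqBox L ∩ B₁ᶜ := by
      rintro z ⟨hz1, hz2⟩
      obtain ⟨hzP, hz0⟩ := triAnn_one_subset_triSqBox_diff d hz1
      refine ⟨hPL hzP, fun h => ?_⟩
      rcases mem_insert_iff.1 h with h | (h | h) | h
      · exact hz0 h
      · exact hW.Wa_out z h hzP
      · exact hW.Wb_out z h hzP
      · exact hz2 h.2
    have h3 : PathIn triGraph (triSqBox L ∩ B₁ᶜ) x u := ((hall₃ u hu.1).mono hS₃).mono hB₁c
    have h4 : PathIn triGraph (triSqBox L ∩ B₁ᶜ) y u' := ((hall₄ u' hu'.1).mono hS₄).mono hB₁c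
    exact hexcl hx hy ((h3.trans (hp.mono hsub)).trans h4.symm)

end CutPoint


/-! ### The cut-point lemma -/

section CutPointMain

variable {d : ℕ} {ξ : SiteConfig (Site 2)} {Sα Sβ : Set (Site 2)} {a₁ a b₁ b : Site 2}

/-- **The cut-point lemma in cluster form, `a` on the right side of `P`** (as
`armEvent_of_cutPoint_right`; the hypotheses `a ≠ b`, `a ≁ b` of the wires follow from the
cut-point hypothesis `H`). [cite: Nolin2008, §6.2, proof of Thm. 27, Case 1 (arXiv 0711.4948: Thm. 26, Fig. 8)] [cite: BollobasRiordan2006, Ch. 5 Lemma 7] -/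
theorem altFourArm_of_cutPoint_right (hd : 1 ≤ d) (hSα : Sα ⊆ (triSqBox d \ {0}) ∩ ξ)
    (hSβ : Sβ ⊆ (triSqBox d \ {0}) ∩ ξ) (ha₁ : triGraph.Adj a₁ 0) (hb₁ : triGraph.Adj b₁ 0)
    (hα : PathIn triGraph Sα a₁ a) (hβ : PathIn triGraph Sβ b₁ b) (ha0 : a 0 = d)
    (hbd : |b 0| = d ∨ |b 1| = d)
    (H : ∀ z ∈ Sα, ∀ z' ∈ Sβ, ¬ PathIn triGraph ((triSqBox d \ {0}) ∩ ξ) z z') :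
    ξ ∈ altFourArm 1 d := by
  have haP : a ∈ triSqBox d := (hSα hα.right_mem).1.1
  have hbP : b ∈ triSqBox d := (hSβ hβ.right_mem).1.1
  have ha1 : |a 1| ≤ d := (mem_triSqBox.1 haP).2
  have hab : a ≠ b := by
    intro h
    have haα : a ∈ Sα := hα.right_mem
    rw [h] at haα
    exact H b haα b hβ.right_mem (PathIn.refl (hSβ hβ.right_mem))
  have hab' : ¬ triGraph.Adj a b := fun h =>
    H a hα.right_mem b hβ.right_mem (PathIn.of_adj (hSα hα.right_mem) (hSβ hβ.right_mem) h)
  obtain ⟨a', b', Wa, Wb, hW⟩ := exists_cutPointWires ha0 ha1 hbP hbd hab hab'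
  have hda : (d : ℤ) ≤ triNorm a := by
    have := (abs_le_triNorm a).1; rw [ha0, abs_of_nonneg (by positivity)] at this; exact this
  have hdb : (d : ℤ) ≤ triNorm b := by
    rcases hbd with h | h
    · have := (abs_le_triNorm b).1; rw [h] at this; exact this
    · have := (abs_le_triNorm b).2.1; rw [h] at this; exact this
  exact altFourArm_of_cutPoint_of_wires hd hW hSα hSβ ha₁ hb₁ hα hβ hda hdb H

end CutPointMain

/-! ### Symmetries: transporting the cut-point lemma -/

section Symmetry

/-- **The alternating four-arm event is invariant under the norm-preserving automorphisms of
`𝕋`** (pull-back form, as `mem_armEvent_of_relabel_iso`): if `φ` preserves `triNorm` and the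
relabelled configuration `φ(ξ)` lies in `altFourArm r R`, so does `ξ` — map the arms by `φ⁻¹`; a
joining path of the annulus for `ξ` is mapped by `φ` to one for `φ(ξ)`. [cite: SmirnovWernerMRL2001, Rem. 2] -/
theorem mem_altFourArm_of_relabel_iso {r R : ℕ} (φ : triGraph ≃g triGraph)
    (hφn : ∀ z, triNorm (φ z) = triNorm z) {ξ : SiteConfig (Site 2)}
    (h : SiteConfig.relabel φ.toEquiv ξ ∈ altFourArm r R) : ξ ∈ altFourArm r R := by
  classical
  obtain ⟨x, y, w, hw, hdisj, hsep₀₂, hsep₁₃⟩ := h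
  have hψn : ∀ z, triNorm (φ.symm z) = triNorm z := fun z => by
    have := hφn (φ.symm z); rw [RelIso.apply_symm_apply] at this; exact this.symm
  set f : triGraph →g triGraph := φ.symm.toEmbedding.toHom with hf
  have hfapp : ∀ z, f z = φ.symm z := fun z => rfl
  have hmemξ : ∀ z, z ∈ SiteConfig.relabel φ.toEquiv ξ ↔ φ.symm z ∈ ξ := fun z =>
    SiteConfig.mem_relabel_iff _ _ _
  -- the annulus and the colours are transported by `φ`
  have hAnn : ∀ z, φ z ∈ triAnn r R ↔ z ∈ triAnn r R := fun z => by
    rw [mem_triAnn, mem_triAnn, hφn]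
  have himg_open : φ '' (triAnn r R ∩ (ξ : Set (Site 2))) ⊆
      triAnn r R ∩ (SiteConfig.relabel φ.toEquiv ξ : Set (Site 2)) := by
    rintro _ ⟨z, ⟨hz1, hz2⟩, rfl⟩
    refine ⟨(hAnn z).2 hz1, (hmemξ _).2 ?_⟩
    rw [RelIso.symm_apply_apply]; exact hz2
  have himg_closed : φ '' (triAnn r R \ (ξ : Set (Site 2))) ⊆
      triAnn r R \ (SiteConfig.relabel φ.toEquiv ξ : Set (Site 2)) := by
    rintro _ ⟨z, ⟨hz1, hz2⟩, rfl⟩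
    refine ⟨(hAnn z).2 hz1, fun h' => hz2 ?_⟩
    have := (hmemξ _).1 h'
    rwa [RelIso.symm_apply_apply] at this
  have hsupp_map : ∀ j, ∀ v ∈ ((w j).map f).support, ∃ u ∈ (w j).support, v = φ.symm u := by
    intro j v hv
    rw [SimpleGraph.Walk.support_map, List.mem_map] at hv
    obtain ⟨u, hu, rfl⟩ := hv
    exact ⟨u, hu, rfl⟩
  refine ⟨fun j => φ.symm (x j), fun j => φ.symm (y j), fun j => (w j).map f, fun j => ?_, ?_, ?_, ?_⟩
  · obtain ⟨hx, hy, hpath, hsupp, hcol⟩ := hw j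
    refine ⟨?_, ?_, hpath.map (f := f) φ.symm.injective, ?_, ?_⟩
    · rw [mem_triSphere_iff, hψn]; exact mem_triSphere_iff.1 hx
    · rw [mem_triSphere_iff, hψn]; exact mem_triSphere_iff.1 hy
    · intro v hv
      rw [SimpleGraph.Walk.support_map, List.mem_map] at hv
      obtain ⟨u, hu, rfl⟩ := hv
      rw [hfapp]
      rcases hsupp u hu with hu' | hu'
      · left
        simp only [mem_sdiff, Finset.mem_coe, mem_triBall_iff, hψn] at hu' ⊢
        exact hu'
      · right; rw [mem_triSphere_iff, hψn]; exact mem_triSphere_iff.1 hu'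
    · intro v hv
      rw [SimpleGraph.Walk.support_map, List.mem_map] at hv
      obtain ⟨u, hu, rfl⟩ := hv
      rw [hfapp, ← hmemξ]
      exact hcol u hu
  · intro i j hij
    rw [Finset.disjoint_left]
    intro v hvi hvj
    rw [List.mem_toFinset, SimpleGraph.Walk.support_map, List.mem_map] at hvi hvj
    obtain ⟨u, hu, rfl⟩ := hvi
    obtain ⟨u', hu', huu'⟩ := hvj
    rw [hfapp, hfapp] at huu'
    have : u' = u := φ.symm.injective huu'
    subst this
    exact Finset.disjoint_left.1 (hdisj hij) (List.mem_toFinset.2 hu) (List.mem_toFinset.2 hu')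
  · intro v hv v' hv' hp
    obtain ⟨u, hu, rfl⟩ := hsupp_map 0 v hv
    obtain ⟨u', hu', rfl⟩ := hsupp_map 2 v' hv'
    have hp' := pathIn_map_iso φ hp
    rw [RelIso.apply_symm_apply, RelIso.apply_symm_apply] at hp'
    exact hsep₀₂ u hu u' hu' (hp'.mono himg_open)
  · intro v hv v' hv' hp
    obtain ⟨u, hu, rfl⟩ := hsupp_map 1 v hv
    obtain ⟨u', hu', rfl⟩ := hsupp_map 3 v' hv'
    have hp' := pathIn_map_iso φ hp
    rw [RelIso.apply_symm_apply, RelIso.apply_symm_apply] at hp'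
    exact hsep₁₃ u hu u' hu' (hp'.mono himg_closed)

variable {d : ℕ} {ξ : SiteConfig (Site 2)} {Sα Sβ : Set (Site 2)} {a₁ a b₁ b : Site 2}

/-- **Transport of the cut-point lemma (cluster form)** by an automorphism `φ` of `𝕋` fixing `0`,
preserving `triNorm` and the box `[-d, d]²`, which moves `a` to the right side (as
`armEvent_of_cutPoint_iso`). [folklore] -/
theorem altFourArm_of_cutPoint_iso (φ : triGraph ≃g triGraph) (hφ0 : φ 0 = 0)
    (hφn : ∀ z, triNorm (φ z) = triNorm z) (hφP : ∀ z, φ z ∈ triSqBox d ↔ z ∈ triSqBox d)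
    (hd : 1 ≤ d) (hSα : Sα ⊆ (triSqBox d \ {0}) ∩ ξ) (hSβ : Sβ ⊆ (triSqBox d \ {0}) ∩ ξ)
    (ha₁ : triGraph.Adj a₁ 0) (hb₁ : triGraph.Adj b₁ 0) (hα : PathIn triGraph Sα a₁ a)
    (hβ : PathIn triGraph Sβ b₁ b) (ha0 : (φ a) 0 = d) (hbd : |(φ b) 0| = d ∨ |(φ b) 1| = d)
    (H : ∀ z ∈ Sα, ∀ z' ∈ Sβ, ¬ PathIn triGraph ((triSqBox d \ {0}) ∩ ξ) z z') :
    ξ ∈ altFourArm 1 d := by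
  set ξ' : SiteConfig (Site 2) := SiteConfig.relabel φ.toEquiv ξ with hξ'
  have hξ'eq : (ξ' : Set (Site 2)) = φ '' ξ := rfl
  have hne0 : ∀ {z : Site 2}, z ≠ 0 → φ z ≠ 0 := fun hz h =>
    hz (φ.injective (h.trans hφ0.symm))
  have himg : ∀ {S : Set (Site 2)}, S ⊆ (triSqBox d \ {0}) ∩ ξ → φ '' S ⊆ (triSqBox d \ {0}) ∩ ξ' := by
    intro S hS
    rintro _ ⟨z, hz, rfl⟩
    obtain ⟨⟨hz1, hz2⟩, hz3⟩ := hS hz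
    exact ⟨⟨(hφP z).2 hz1, hne0 hz2⟩, hξ'eq ▸ mem_image_of_mem _ hz3⟩
  have hadj : ∀ {u : Site 2}, triGraph.Adj u 0 → triGraph.Adj (φ u) 0 := fun hu => by
    rw [← hφ0]; exact φ.map_adj_iff.2 hu
  have H' : ∀ z ∈ φ '' Sα, ∀ z' ∈ φ '' Sβ, ¬ PathIn triGraph ((triSqBox d \ {0}) ∩ ξ') z z' := by
    rintro _ ⟨z, hz, rfl⟩ _ ⟨z', hz', rfl⟩ hp
    have hp' := pathIn_map_iso φ.symm hp
    simp only [RelIso.symm_apply_apply] at hp'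
    refine H z hz z' hz' (hp'.mono ?_)
    rintro _ ⟨w, ⟨⟨hw1, hw2⟩, hw3⟩, rfl⟩
    refine ⟨⟨?_, ?_⟩, ?_⟩
    · have := hφP (φ.symm w); rw [RelIso.apply_symm_apply] at this; exact this.1 hw1
    · intro h0
      apply hw2
      have h0' : φ.symm w = 0 := h0
      have : w = φ (φ.symm w) := (RelIso.apply_symm_apply φ w).symm
      rw [this, h0', hφ0]; rfl
    · rw [hξ'eq] at hw3
      obtain ⟨u, hu, rfl⟩ := hw3
      simpa using hu
  have h := altFourArm_of_cutPoint_right hd (himg hSα) (himg hSβ) (hadj ha₁) (hadj hb₁)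
    (pathIn_map_iso φ hα) (pathIn_map_iso φ hβ) ha0 hbd H'
  exact mem_altFourArm_of_relabel_iso φ hφn h

/-- **The cut-point lemma, cluster form**: two open paths inside `[-d, d]² \ {0}` from neighbours
of `0` to boundary sites `a`, `b` of `[-d, d]²` that cannot be joined by an open path inside
`[-d, d]² \ {0}` force four ALTERNATING arms from `∂Λ₁` to `∂Λ_d` in the cluster form of
`altFourArm` (Nolin 2008, §6.2, proof of Thm. 27, Case 1, Fig. 8: "`r₁` provides two black arms,
and `c₁` two white arms"). Reduced to `a` on the right side by the symmetries `z ↦ -z`,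
`(z₀, z₁) ↦ (z₁, z₀)` (as `armEvent_of_cutPoint`). [cite: Nolin2008, §6.2, proof of Thm. 27, Case 1 (arXiv 0711.4948: Thm. 26, Fig. 8)] [cite: BollobasRiordan2006, Ch. 5 Lemma 7] -/
theorem altFourArm_of_cutPoint (hd : 1 ≤ d) (hSα : Sα ⊆ (triSqBox d \ {0}) ∩ ξ)
    (hSβ : Sβ ⊆ (triSqBox d \ {0}) ∩ ξ) (ha₁ : triGraph.Adj a₁ 0) (hb₁ : triGraph.Adj b₁ 0)
    (hα : PathIn triGraph Sα a₁ a) (hβ : PathIn triGraph Sβ b₁ b)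
    (had : |a 0| = d ∨ |a 1| = d) (hbd : |b 0| = d ∨ |b 1| = d)
    (H : ∀ z ∈ Sα, ∀ z' ∈ Sβ, ¬ PathIn triGraph ((triSqBox d \ {0}) ∩ ξ) z z') :
    ξ ∈ altFourArm 1 d := by
  have hd0 : (0 : ℤ) ≤ d := by positivity
  -- the four symmetries
  have hnegP : ∀ z : Site 2, triNegIso z ∈ triSqBox d ↔ z ∈ triSqBox d := fun z => by
    simp [mem_triSqBox, abs_neg]
  have hswapP : ∀ z : Site 2, triSwapIso z ∈ triSqBox d ↔ z ∈ triSqBox d := fun z => by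
    simp only [mem_triSqBox, triSwapIso_apply, transposeIso_apply_zero, transposeIso_apply_one]
    tauto
  have hnegn : ∀ z : Site 2, triNorm (triNegIso z) = triNorm z := fun z => by
    rw [triNegIso_apply, triNorm_neg]
  have hswapn : ∀ z : Site 2, triNorm (triSwapIso z) = triNorm z := fun z => by
    rw [triSwapIso_apply, triNorm_transposeIso]
  rcases had with h | h
  · rcases (abs_eq hd0).1 h with h | h
    · exact altFourArm_of_cutPoint_right hd hSα hSβ ha₁ hb₁ hα hβ h hbd H
    · refine altFourArm_of_cutPoint_iso triNegIso (by simp) hnegn hnegP hd hSα hSβ ha₁ hb₁ hα hβ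
        (by rw [triNegIso_apply, Pi.neg_apply, h, neg_neg]) ?_ H
      simpa [abs_neg] using hbd
  · rcases (abs_eq hd0).1 h with h | h
    · refine altFourArm_of_cutPoint_iso triSwapIso ?_ hswapn hswapP hd hSα hSβ ha₁ hb₁ hα hβ
        (by rw [triSwapIso_apply, transposeIso_apply_zero, h]) ?_ H
      · ext i; fin_cases i <;> simp
      · simp only [triSwapIso_apply, transposeIso_apply_zero, transposeIso_apply_one]; tauto
    · refine altFourArm_of_cutPoint_iso (triSwapIso.trans triNegIso) ?_ ?_ ?_ hd hSα hSβ ha₁ hb₁ hα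
        hβ ?_ ?_ H
      · ext i; fin_cases i <;> simp
      · intro z
        show triNorm (triNegIso (triSwapIso z)) = triNorm z
        rw [hnegn, hswapn]
      · intro z
        show triNegIso (triSwapIso z) ∈ triSqBox d ↔ z ∈ triSqBox d
        rw [hnegP, hswapP]
      · show (triNegIso (triSwapIso a)) 0 = d
        rw [triNegIso_apply, Pi.neg_apply, triSwapIso_apply, transposeIso_apply_zero, h, neg_neg]
      · show |(triNegIso (triSwapIso b)) 0| = d ∨ |(triNegIso (triSwapIso b)) 1| = d
        simp only [triNegIso_apply, Pi.neg_apply, triSwapIso_apply, transposeIso_apply_zero,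
          transposeIso_apply_one, abs_neg]
        tauto

end Symmetry


/-! ### Application: a pivotal site of the one-arm event has four arms locally -/

section OneArm

variable {N d : ℕ} {v : Site 2} {ω : SiteConfig (Site 2)}

/-- **A pivotal site of the one-arm event is a local ALTERNATING four-arm site** (Nolin 2008,
§6.2, proof of Thm. 27, Case 1, Fig. 8; Werner 2009, Lecture 6, §5; Kesten 1987, Lemma 8; as
`relabel_shift_mem_armEvent_of_isPivotal_triOneArm` with the cluster-form conclusion). If `v` is
pivotal for `{0 ↔ ∂Λ_N}` (`triOneArm N`) in `ω`, `d ≥ 1`, `2d + 1 ≤ |v|_𝕋` and `|v|_𝕋 + 2d ≤ N`,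
then the translated configuration `ω - v` lies in `altFourArm 1 d`: the open path
of `ω ∪ {v}` from `0` to `∂Λ_N` passes through `v`; its two halves, seen from `v` and stopped on
the boundary of `v + [-d, d]²`, are open paths that no open path of `ω \ {v}` inside
`v + [-d, d]² ⊆ Λ_N` can join (that would make `ω \ {v} ∈ {0 ↔ ∂Λ_N}`), so the cut-point lemma
applies. [cite: Nolin2008, §6.2, proof of Thm. 27, Case 1 (arXiv 0711.4948: Thm. 26, Fig. 8)] [cite: WernerPCMI2009, Lecture 6, §5 (figure: a pivotal point for 0 ↔ ∂Λ_n)] -/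
theorem relabel_shift_mem_altFourArm_of_isPivotal_triOneArm (hd : 1 ≤ d)
    (hv : 2 * (d : ℤ) + 1 ≤ triNorm v) (hvN : triNorm v + 2 * d ≤ N)
    (hpiv : IsPivotal (triOneArm N) v ω) :
    SiteConfig.relabel (triShiftIso (-v)).toEquiv ω ∈ altFourArm 1 d := by
  classical
  have hd0 : (0 : ℤ) ≤ d := by positivity
  set Λ : Set (Site 2) := ↑(triBall N) with hΛ
  have hΛmem : ∀ {z : Site 2}, z ∈ Λ ↔ triNorm z ≤ N := fun {z} => by
    rw [hΛ, Finset.mem_coe, mem_triBall_iff]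
  rw [isPivotal_iff_insert_mem_and_notMem (isUpperSet_triOneArm N)] at hpiv
  obtain ⟨⟨y, hy, hconn⟩, hnot⟩ := hpiv
  rw [mem_triSphere_iff] at hy
  have hγ : PathIn triGraph (Λ ∩ insert v ω) 0 y := PathIn.of_mem_siteConnIn hconn
  set A : Set (Site 2) := (Λ ∩ insert v ω) \ {v} with hA
  set A' : Set (Site 2) := Λ ∩ (ω \ {v}) with hA'
  have hAsub : A ⊆ A' := inter_insert_diff_subset Λ v ω
  have hv0 : (v : Site 2) ≠ 0 := by
    intro h; rw [h] at hv; simp [triNorm] at hv; omega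
  have hyv : y ≠ v := by intro h; rw [h] at hy; omega
  -- the open path passes through `v`
  rcases hγ.split_at v with havoid | ⟨hP, hS⟩
  · exact (hnot ⟨y, mem_triSphere_iff.2 hy, (havoid.mono hAsub).mem_siteConnIn⟩).elim
  obtain ⟨a₁', ha₁', hpre⟩ := hP.resolve_left hv0.symm
  obtain ⟨b₁', hb₁', hsuf⟩ := hS.resolve_left hyv
  -- translate by `-v`
  set φ := triShiftIso (-v) with hφ
  have hφapp : ∀ w, φ w = w - v := fun w => by simp [hφ, sub_eq_add_neg]
  have himage : ∀ (T : Set (Site 2)) (w : Site 2), w ∈ φ '' T ↔ w + v ∈ T := by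
    intro T w
    constructor
    · rintro ⟨w', hw', rfl⟩; rw [hφapp]; simpa using hw'
    · intro hw; exact ⟨w + v, hw, by rw [hφapp]; simp⟩
  set ξ : SiteConfig (Site 2) := SiteConfig.relabel φ.toEquiv ω with hξ
  have hmemξ : ∀ w, w ∈ ξ ↔ w + v ∈ ω := by
    intro w
    rw [hξ, SiteConfig.mem_relabel_iff]
    have : φ.toEquiv.symm w = w + v := by
      apply φ.toEquiv.injective
      rw [Equiv.apply_symm_apply]
      show w = φ (w + v)
      rw [hφapp]; simp
    rw [this]
  -- the translated half-paths, from neighbours of `0`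
  have hα₀ : PathIn triGraph (φ '' A) (φ a₁') (φ 0) := pathIn_map_iso φ hpre.symm
  have hβ₀ : PathIn triGraph (φ '' A) (φ b₁') (φ y) := pathIn_map_iso φ hsuf.symm
  have hadj : ∀ {u : Site 2}, triGraph.Adj u v → triGraph.Adj (φ u) 0 := by
    intro u hu
    have := φ.map_adj_iff.2 hu
    rwa [show φ v = 0 by rw [hφapp, sub_self]] at this
  -- sites of `φ '' A` are open sites of `ξ` other than `0`
  have hAξ : ∀ w ∈ φ '' A, w ∈ ξ ∧ w ≠ 0 := by
    intro w hw
    rw [himage] at hw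
    obtain ⟨⟨-, hw2⟩, hw3⟩ := hw
    have hw3' : w + v ≠ v := hw3
    refine ⟨(hmemξ w).2 ((mem_insert_iff.1 hw2).resolve_left hw3'), fun h => hw3' ?_⟩
    rw [h, zero_add]
  -- the interior of the box; the far endpoints lie outside it
  set R : Set (Site 2) := {z | |z 0| < d ∧ |z 1| < d} with hR
  have hRmem : ∀ {z : Site 2}, z ∈ R ↔ |z 0| < d ∧ |z 1| < d := fun {z} => Iff.rfl
  have hfar : ∀ {w : Site 2}, 2 * (d : ℤ) ≤ triNorm w → w ∉ R := by
    intro w hw hwR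
    obtain ⟨h0, h1⟩ := hwR
    have := triNorm_le_abs_add_abs w
    omega
  have hφ0far : φ 0 ∉ R := by
    apply hfar
    rw [hφapp, zero_sub, triNorm_neg]; omega
  have hφyfar : φ y ∉ R := by
    apply hfar
    rw [hφapp]
    have := triNorm_add_le (y - v) v
    rw [sub_add_cancel] at this
    omega
  -- stopping a half-path on the boundary of the box, with a tight support
  have stop : ∀ {u₁ e : Site 2}, triGraph.Adj u₁ 0 → e ∉ R → PathIn triGraph (φ '' A) u₁ e →
      ∃ (S : Set (Site 2)) (c : Site 2), S ⊆ triSqBox d ∩ φ '' A ∧ PathIn triGraph S u₁ c ∧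
        (|c 0| = d ∨ |c 1| = d) ∧ ∀ z ∈ S, PathIn triGraph (φ '' A) u₁ z := by
    intro u₁ e hu₁ he hp
    have hu₁1 : triNorm u₁ = 1 := by
      have := triNorm_sub_eq_one_of_adj hu₁; rwa [sub_zero] at this
    obtain ⟨hu0, hu1, -⟩ := abs_le_triNorm u₁
    by_cases huR : u₁ ∈ R
    · obtain ⟨p, q, hpR, hqR, hqA, hpq, hpath⟩ := hp.exit huR he
      have hpath' : PathIn triGraph (insert q (R ∩ φ '' A)) u₁ q :=
        (hpath.mono fun z hz => mem_insert_of_mem _ hz).tail hpq (mem_insert q _)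
      obtain ⟨S, hS, hSp, hall⟩ := hpath'.exists_support
      have hq : q ∈ triSqBox d ∧ (|q 0| = d ∨ |q 1| = d) := by
        rw [hRmem, abs_lt, abs_lt] at hpR
        rw [hRmem, not_and_or, not_lt, not_lt, le_abs, le_abs] at hqR
        rw [triGraph_adj_iff_coord] at hpq
        rw [mem_triSqBox, abs_le, abs_le, abs_eq hd0, abs_eq hd0]
        omega
      have hSsub : S ⊆ triSqBox d ∩ φ '' A := by
        intro z hz
        rcases hS hz with h | ⟨hzR, hzA⟩
        · rw [h]; exact ⟨hq.1, hqA⟩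
        · rw [hRmem, abs_lt, abs_lt] at hzR
          exact ⟨by rw [mem_triSqBox, abs_le, abs_le]; omega, hzA⟩
      exact ⟨S, q, hSsub, hSp, hq.2, fun z hz => (hall z hz).mono fun w hw => (hSsub hw).2⟩
    · refine ⟨{u₁}, u₁, ?_, PathIn.refl (mem_singleton u₁), ?_, ?_⟩
      · intro z hz
        rw [mem_singleton_iff] at hz
        rw [hz]
        exact ⟨by rw [mem_triSqBox]; constructor <;> omega, hp.left_mem⟩
      · rw [hRmem, not_and_or, not_lt, not_lt] at huR
        rcases huR with h | h
        · left; omega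
        · right; omega
      · intro z hz
        rw [mem_singleton_iff] at hz
        rw [hz]
        exact PathIn.refl hp.left_mem
  obtain ⟨Sα, a, hSα, hα, had, hallα⟩ := stop (hadj ha₁') hφ0far hα₀
  obtain ⟨Sβ, b, hSβ, hβ, hbd, hallβ⟩ := stop (hadj hb₁') hφyfar hβ₀
  have hSα' : Sα ⊆ (triSqBox d \ {0}) ∩ ξ := fun z hz =>
    ⟨⟨(hSα hz).1, (hAξ z (hSα hz).2).2⟩, (hAξ z (hSα hz).2).1⟩
  have hSβ' : Sβ ⊆ (triSqBox d \ {0}) ∩ ξ := fun z hz =>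
    ⟨⟨(hSβ hz).1, (hAξ z (hSβ hz).2).2⟩, (hAξ z (hSβ hz).2).1⟩
  refine altFourArm_of_cutPoint hd hSα' hSβ' (hadj ha₁') (hadj hb₁') hα hβ had hbd ?_
  -- the cut-point hypothesis: an open junction inside the box would bypass `v`
  intro z hz z' hz' hp
  have hT₁ : φ '' A ⊆ φ '' A' := image_mono hAsub
  have hT₂ : (triSqBox d \ {0}) ∩ ξ ⊆ φ '' A' := by
    rintro w ⟨⟨hw1, hw2⟩, hw3⟩
    rw [himage]
    refine ⟨?_, (hmemξ w).1 hw3, fun h => hw2 ?_⟩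
    · rw [hΛmem]
      have h1 := triNorm_add_le w v
      have h2 := triNorm_le_abs_add_abs w
      rw [mem_triSqBox] at hw1
      omega
    · have : w + v = v := h
      simpa using this
  have hjoin : PathIn triGraph (φ '' A') (φ 0) (φ y) :=
    (((hα₀.symm.trans (hallα z hz)).mono hT₁).trans (hp.mono hT₂)).trans
      (((hallβ z' hz').symm.trans hβ₀).mono hT₁)
  -- translate back by `+v`
  have hback := pathIn_map_iso (triShiftIso v) hjoin
  have e1 : ∀ w, triShiftIso v (φ w) = w := fun w => by rw [triShiftIso_apply, hφapp]; abel
  rw [e1, e1] at hback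
  have hset : (triShiftIso v) '' (φ '' A') = A' := by
    ext u
    constructor
    · rintro ⟨w, hw, rfl⟩
      rw [himage] at hw
      rw [triShiftIso_apply]; exact hw
    · intro hu
      refine ⟨u - v, (himage A' (u - v)).2 (by rwa [sub_add_cancel]), ?_⟩
      rw [triShiftIso_apply, sub_add_cancel]
  rw [hset] at hback
  exact hnot ⟨y, mem_triSphere_iff.2 hy, hback.mem_siteConnIn⟩

end OneArm


/-! ### The pivotal bound with the alternating four-arm probability -/

section Bound

variable {N d r₀ k m m' : ℕ} {v : Site 2}

/-- **A pivotal site of the one-arm event: one arm inside, four ALTERNATING arms locally, one arm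
outside** (as `isPivotal_triOneArm_subset`, `OneArmPivotalBound.lean`, with `altFourArm`): for
`|v|_𝕋 = k`, `1 ≤ r₀ ≤ d`, `2d + 1 ≤ k`, `k + 2d ≤ N`, `m + d + 1 ≤ k` and `k + d + 1 ≤ m' ≤ N`,
`{v pivotal for 0 ↔ ∂Λ_N} ⊆ {0 ↔ ∂Λ_m} ∩ (v + altFourArm r₀ d) ∩ armEvent ![T] m' N`. [cite: Nolin2008, §6.2, proof of Thm. 27, Case 1 (arXiv 0711.4948: Thm. 26)] [cite: WernerPCMI2009, Lecture 6, §5 ("Using differential inequalities for the one-arm event")] -/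
theorem isPivotal_triOneArm_subset_alt (hr₀ : 1 ≤ r₀) (hrd : r₀ ≤ d) (hk : triNorm v = k)
    (hkd : 2 * d + 1 ≤ k) (hkN : k + 2 * d ≤ N) (hm : m + d + 1 ≤ k) (hm' : k + d + 1 ≤ m')
    (hm'N : m' ≤ N) :
    {ω : SiteConfig (Site 2) | IsPivotal (triOneArm N) v ω} ⊆
      triOneArm m ∩ (SiteConfig.relabel (triShiftIso (-v)).toEquiv ⁻¹' altFourArm r₀ d ∩
        armEvent ![true] m' N) := by
  intro ω hω
  have hd : 1 ≤ d := hr₀.trans hrd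
  have hloc := relabel_shift_mem_altFourArm_of_isPivotal_triOneArm (N := N) (v := v) (ω := ω) hd
    (by rw [hk]; exact_mod_cast hkd) (by rw [hk]; exact_mod_cast hkN) hω
  obtain ⟨h1, -, h3⟩ := isPivotal_triOneArm_subset hr₀ hrd hk hkd hkN hm hm' hm'N hω
  exact ⟨h1, altFourArm_mono_left hr₀ hrd hloc, h3⟩

/-- The translate to `v` of the alternating four-arm event is determined by the sites of the
translated annulus `v + (Λ_d \ Λ_{r₀-1})` (as `determinedBy_preimage_shift_armEvent`). [folklore] -/
theorem determinedBy_preimage_shift_altFourArm (hrd : r₀ ≤ d) (v : Site 2) :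
    DeterminedBy (SiteConfig.relabel (triShiftIso (-v)).toEquiv ⁻¹' altFourArm r₀ d)
      (↑((triAnnulus r₀ d).image fun u => u + v) : Set (Site 2)) := by
  have h := determinedBy_preimage_relabel (triShiftIso (-v)).toEquiv (determinedBy_altFourArm hrd)
  rw [Finset.coe_image]
  convert h using 1
  ext z
  simp only [Set.mem_image, Finset.mem_coe]
  constructor
  · rintro ⟨u, hu, rfl⟩
    refine ⟨u, hu, ?_⟩
    apply (triShiftIso (-v)).toEquiv.injective
    rw [Equiv.apply_symm_apply]
    show u = triShiftIso (-v) (u + v)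
    simp
  · rintro ⟨u, hu, rfl⟩
    refine ⟨u, hu, ?_⟩
    apply (triShiftIso (-v)).toEquiv.injective
    rw [Equiv.apply_symm_apply]
    show triShiftIso (-v) (u + v) = u
    simp

/-- **The pivotal bound for the one-arm event with Werner's alternating `π̂`** (Nolin 2008, §6.2,
proof of Thm. 27, Case 1, "by independence of the three events, since they are defined in terms
of sites in disjoint sets"; Werner 2009, Lecture 6, §5; as `measureReal_isPivotal_triOneArm_le`
with `altFourArmProbAt` in place of `fourArmProbAt`). Under the hypotheses of
`isPivotal_triOneArm_subset_alt`,
`P_t(v pivotal for 0 ↔ ∂Λ_N) ≤ P_t(0 ↔ ∂Λ_m) · π̂^alt_t(r₀, d) · P_t(armEvent ![T] m' N)`. [cite: Nolin2008, §6.2, proof of Thm. 27, Case 1 (arXiv 0711.4948: Thm. 26)] [cite: WernerPCMI2009, Lecture 6, §5 ("Using differential inequalities for the one-arm event")] -/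
theorem measureReal_isPivotal_triOneArm_le_alt (t : unitInterval) (hr₀ : 1 ≤ r₀) (hrd : r₀ ≤ d)
    (hk : triNorm v = k) (hkd : 2 * d + 1 ≤ k) (hkN : k + 2 * d ≤ N) (hm : m + d + 1 ≤ k)
    (hm' : k + d + 1 ≤ m') (hm'N : m' ≤ N) :
    (triSitePercolation t).real {ω | IsPivotal (triOneArm N) v ω} ≤
      (triSitePercolation t).real (triOneArm m) *
        (altFourArmProbAt t r₀ d * (triSitePercolation t).real (armEvent ![true] m' N)) := by
  classical
  set e := (triShiftIso (-v)).toEquiv with he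
  set A : Set (SiteConfig (Site 2)) := triOneArm m with hA
  set B : Set (SiteConfig (Site 2)) := SiteConfig.relabel e ⁻¹' altFourArm r₀ d with hB
  set C : Set (SiteConfig (Site 2)) := armEvent ![true] m' N with hC
  -- determining sets
  set F : Finset (Site 2) := triBall m with hF
  set G : Finset (Site 2) := (triAnnulus r₀ d).image fun u => u + v with hG
  set H : Finset (Site 2) := triAnnulus m' N with hH
  have hAF : DeterminedBy A ↑F := determinedBy_triOneArm m
  have hBG : DeterminedBy B ↑G := determinedBy_preimage_shift_altFourArm hrd v
  have hCH : DeterminedBy C ↑H := determinedBy_armEvent _ hm'N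
  have hGmem : ∀ z ∈ G, triNorm v - d ≤ triNorm z ∧ triNorm z ≤ triNorm v + d := by
    intro z hz
    have hz' : z ∈ (fun u => u + v) '' (↑(triAnnulus r₀ d) : Set (Site 2)) := by
      rw [← Finset.coe_image]; exact Finset.mem_coe.2 hz
    exact ⟨le_triNorm_of_mem_shift_annulus hz', triNorm_le_add_of_mem_shift_annulus hz'⟩
  have hFG : Disjoint F G := by
    rw [Finset.disjoint_left]
    intro z hzF hzG
    rw [hF, mem_triBall_iff] at hzF
    have := (hGmem z hzG).1
    omega
  have hGH : Disjoint G H := by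
    rw [Finset.disjoint_left]
    intro z hzG hzH
    rw [hH, mem_triAnnulus] at hzH
    have := (hGmem z hzG).2
    omega
  have hFH : Disjoint F H := by
    rw [Finset.disjoint_left]
    intro z hzF hzH
    rw [hF, mem_triBall_iff] at hzF
    rw [hH, mem_triAnnulus] at hzH
    omega
  have hBC : DeterminedBy (B ∩ C) ↑(G ∪ H) :=
    (hBG.mono (by rw [Finset.coe_union]; exact subset_union_left)).inter
      (hCH.mono (by rw [Finset.coe_union]; exact subset_union_right))
  have hFGH : Disjoint F (G ∪ H) := Finset.disjoint_union_right.2 ⟨hFG, hFH⟩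
  -- independence and translation invariance
  have h1 : (triSitePercolation t).real (A ∩ (B ∩ C)) =
      (triSitePercolation t).real A * (triSitePercolation t).real (B ∩ C) :=
    sitePercolation_real_inter_of_disjoint t hAF hBC hFGH
  have h2 : (triSitePercolation t).real (B ∩ C) =
      (triSitePercolation t).real B * (triSitePercolation t).real C :=
    sitePercolation_real_inter_of_disjoint t hBG hCH hGH
  have h3 : (triSitePercolation t).real B = altFourArmProbAt t r₀ d := by
    rw [altFourArmProbAt, hB, triSitePercolation]
    exact sitePercolation_real_preimage_relabel e t _
  calc (triSitePercolation t).real {ω | IsPivotal (triOneArm N) v ω}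
      ≤ (triSitePercolation t).real (A ∩ (B ∩ C)) :=
        measureReal_mono (isPivotal_triOneArm_subset_alt hr₀ hrd hk hkd hkN hm hm' hm'N)
    _ = (triSitePercolation t).real A *
          (altFourArmProbAt t r₀ d * (triSitePercolation t).real C) := by rw [h1, h2, h3]

end Bound

end Literature.Probability.Percolation
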